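import Mathlib.Analysis.InnerProductSpace.Calculus
import Mathlib.Analysis.InnerProductSpace.Trace
import Mathlib.LinearAlgebra.Trace
import Mathlib.MeasureTheory.Integral.Bochner.Basic
import Mathlib.MeasureTheory.Measure.Haar.InnerProductSpace
import Mathlib.MeasureTheory.Constructions.Pi
import Literature.Probability.LatticeModels.ConformalCovariance
import HarnessLib

/-!
# The weak special-conformal Ward identity for `n`-point functions on `ℝᵈ`

Di Francesco–Mathieu–Sénéchal, *Conformal Field Theory* (Springer 1997) [`FrancescoMathieuSenechal1997`],
§4.1: the infinitesimal special conformal transformation (SCT) of `ℝᵈ` with parameter `b` is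
"(4.14) `x'^μ = x^μ + 2(x·b) x^μ - b^μ x²`", with generator "(SCT) `K_μ = -i(2 x_μ x^ν ∂_ν - x² ∂_μ)`
(4.18)" and finite form (4.15) (an inversion–translation–inversion, (4.17)); §4.3.1 (4.51)–(4.54):
covariance of quasi-primary correlators of weight `Δ` under SCTs fixes the two-point function
`C₁₂ / |x₁ - x₂|^{2Δ}`. Infinitesimally, covariance of an `n`-point function `S_n` of `n` fields of
equal weight `Δ` under the SCT flow reads, on non-coincident configurations,

  `Σᵢ K_b(xᵢ) · ∇ᵢ S_n (x) = 2Δ (Σᵢ b·xᵢ) S_n (x)`,   `K_b(x) := ‖x‖² b - 2(b·x) x`     (P)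

(`K_b = -δ_b x` is the displacement (4.14) for the parameter `-b`; `div K_b = -2d (b·x)`), and its
WEAK (distributional) form, obtained by testing (P) against `φ ∈ C_c^∞(NonCoincident)` and
integrating by parts (the adjoint of `K_b·∇` is `-K_b·∇ - div K_b = -K_b·∇ + 2d (b·x)`), is

  `∫ S_n(x) [ (2Δ - 2d)(Σᵢ b·xᵢ) φ(x) + Dφ(x)[(K_b(xᵢ))ᵢ] ] dx = 0`.                    (W)

## Contents

* `sctField b x = ‖x‖² • b - (2⟪b, x⟫) • x` — the field `K_b` of (P)/(W), with its algebra
  (linearity in `b`, `⟪x, K_b x⟫ = -⟪b,x⟫‖x‖²`, the two-point identity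
  `⟪x - y, K_b x - K_b y⟫ = -(⟪b,x⟫ + ⟪b,y⟫)‖x - y‖²`, its derivative `sctFieldDeriv` / `hasFDerivAt_sctField` and
  **`div K_b = -2d ⟪b, x⟫`** as the trace of the derivative, `trace_fderiv_sctField` — the origin of
  the coefficient `2Δ - 2d` in (W));
* `sctTestOp Δ n b φ x` — the adjoint first-order operator of (W) applied to a test function;
* `SCTWardWeak S Δ n` — (W) for the `n`-point function of a correlation family `S : CorrFamily d`
  (test functions: `ContDiff ℝ ∞`, compact support, `tsupport φ ⊆ NonCoincident d n`), spelled
  LITERALLY as inlined (with `d = 3`, coefficient `2Δ - 6`) in items 5352/5356/5357 of the route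
  `CriticalPhenomena/Ising3DConformalLimit/PrimaryAtInfinity`; `sctWardWeak_iff_coeff` rewrites the
  coefficient (e.g. to `2Δ - 6`), `sctWardWeak_iff_sctTestOp` folds the operator;
* `SCTWardPointwise S Δ n` — the pointwise identity (P) (`fderiv` of `S n` along the configuration
  field);
* cheap API: `SCTWardWeak.of_forall_eq_zero`, `SCTWardPointwise.of_forall_eq_zero`.

## Not here (follow-ups; theorem-level, no new notions)

(P) ⇔ (W) for `S n` of class `C¹` on `NonCoincident` (integration by parts on the open set with a
cut-off; du Bois-Reymond), (P) for `c‖x₀ - x₁‖^{-2Δ}` (from `inner_sub_sctField_sub`) and for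
Hafnians of two-point functions, the invariance of the test class under the flows of `P_a`, `K_b`,
and the commutator `[K_b, P_a] = 2(a·b)(Σ xᵢ·∇ᵢ + nΔ) - 2 M_{ab}` on test functions ((4.19)).

## References

* [FrancescoMathieuSenechal1997] P. Di Francesco, P. Mathieu, D. Sénéchal, *Conformal Field
  Theory*, Springer GTCP (1997), §4.1 (4.14)–(4.19), §4.2.1 (4.31)–(4.32), §4.3.1 (4.51)–(4.54).
* M. Lüscher, G. Mack, *Global conformal invariance in quantum field theory*, Comm. Math. Phys. 41
  (1975) 203–234 (infinitesimal ⇒ global conformal invariance of Euclidean Green functions).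
-/

noncomputable section

open MeasureTheory
open scoped InnerProductSpace RealInnerProductSpace

namespace Literature.Probability.LatticeModels

variable {d : ℕ}

/-! ### The special conformal vector field `K_b` -/

/-- The **special conformal vector field** with parameter `b ∈ ℝᵈ`:
`K_b(x) = ‖x‖² b - 2 (b·x) x` — minus the infinitesimal SCT displacement (4.14)
`δx = 2(x·b)x - b x²` of Di Francesco–Mathieu–Sénéchal (i.e. (4.14) for the parameter `-b`); the
first-order part of the generator `K_μ` of (4.18) contracted with `b`. [cite: FrancescoMathieuSenechal1997, §4.1 (4.14) and (4.18)] -/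
def sctField (b x : EuclideanSpace ℝ (Fin d)) : EuclideanSpace ℝ (Fin d) :=
  ‖x‖ ^ 2 • b - (2 * ⟪b, x⟫) • x

/-- Unfolding lemma for `sctField`. [folklore] -/
theorem sctField_apply (b x : EuclideanSpace ℝ (Fin d)) :
    sctField b x = ‖x‖ ^ 2 • b - (2 * ⟪b, x⟫) • x := rfl

/-- `K_0 = 0`. [folklore] -/
@[simp] theorem sctField_zero_left (x : EuclideanSpace ℝ (Fin d)) : sctField 0 x = 0 := by
  simp [sctField]

/-- `K_b(0) = 0` (the SCT flow fixes the origin). [folklore] -/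
@[simp] theorem sctField_zero_right (b : EuclideanSpace ℝ (Fin d)) : sctField b 0 = 0 := by
  simp [sctField]

/-- `K_b` is additive in the parameter `b`. [folklore] -/
theorem sctField_add_left (b b' x : EuclideanSpace ℝ (Fin d)) :
    sctField (b + b') x = sctField b x + sctField b' x := by
  simp only [sctField, inner_add_left, smul_add, mul_add, add_smul]
  abel

/-- `K_b` is homogeneous in the parameter `b`. [folklore] -/
theorem sctField_smul_left (c : ℝ) (b x : EuclideanSpace ℝ (Fin d)) :
    sctField (c • b) x = c • sctField b x := by
  simp only [sctField, real_inner_smul_left, smul_sub, smul_smul]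
  congr 1
  · rw [mul_comm]
  · ring_nf

/-- `K_{-b} = -K_b` (so the sign convention relative to (4.14) is immaterial for linear
identities). [folklore] -/
theorem sctField_neg_left (b x : EuclideanSpace ℝ (Fin d)) : sctField (-b) x = -sctField b x := by
  rw [← neg_one_smul ℝ b, sctField_smul_left, neg_one_smul]

/-- The radial component of `K_b`: `⟪x, K_b(x)⟫ = -⟪b, x⟫ ‖x‖²`. [folklore] -/
theorem inner_self_sctField (b x : EuclideanSpace ℝ (Fin d)) :
    ⟪x, sctField b x⟫ = -⟪b, x⟫ * ‖x‖ ^ 2 := by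
  rw [sctField, inner_sub_right, real_inner_smul_right, real_inner_smul_right,
    real_inner_self_eq_norm_sq, real_inner_comm x b]
  ring

/-- **The two-point identity**: `⟪x - y, K_b(x) - K_b(y)⟫ = -(⟪b, x⟫ + ⟪b, y⟫) ‖x - y‖²` — the
algebra behind the SCT covariance of `c‖x - y‖^{-2Δ}` ((4.51)–(4.54): the pointwise identity (P)
for the two-point function reduces to it by the chain rule). [cite: FrancescoMathieuSenechal1997, §4.3.1 (4.51)–(4.54)] -/
theorem inner_sub_sctField_sub (b x y : EuclideanSpace ℝ (Fin d)) :
    ⟪x - y, sctField b x - sctField b y⟫ = -(⟪b, x⟫ + ⟪b, y⟫) * ‖x - y‖ ^ 2 := by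
  have hxy : ‖x - y‖ ^ 2 = ‖x‖ ^ 2 - 2 * ⟪x, y⟫ + ‖y‖ ^ 2 := norm_sub_sq_real x y
  simp only [sctField, inner_sub_left, inner_sub_right, real_inner_smul_right,
    real_inner_self_eq_norm_sq, real_inner_comm x b, real_inner_comm y b, real_inner_comm x y, hxy]
  ring

/-- The derivative of `K_b` at `x` as a continuous linear map:
`h ↦ 2⟪x, h⟫ b - 2⟪b, h⟫ x - 2⟪b, x⟫ h`. [folklore] -/
def sctFieldDeriv (b x : EuclideanSpace ℝ (Fin d)) :
    EuclideanSpace ℝ (Fin d) →L[ℝ] EuclideanSpace ℝ (Fin d) :=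
  (innerSL ℝ x).smulRight ((2 : ℝ) • b) -
    ((innerSL ℝ b).smulRight ((2 : ℝ) • x) +
      (2 * ⟪b, x⟫) • ContinuousLinearMap.id ℝ (EuclideanSpace ℝ (Fin d)))

/-- Unfolding lemma for `sctFieldDeriv`. [folklore] -/
theorem sctFieldDeriv_apply (b x h : EuclideanSpace ℝ (Fin d)) :
    sctFieldDeriv b x h = ⟪x, h⟫ • ((2 : ℝ) • b) - (⟪b, h⟫ • ((2 : ℝ) • x) + (2 * ⟪b, x⟫) • h) :=
  rfl

/-- **The derivative of `K_b`**: `DK_b(x)[h] = 2⟪x, h⟫ b - 2⟪b, h⟫ x - 2⟪b, x⟫ h` (product rules for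
`‖x‖² b` and `⟪b, x⟫ x`). [folklore] -/
theorem hasFDerivAt_sctField (b x : EuclideanSpace ℝ (Fin d)) :
    HasFDerivAt (sctField b) (sctFieldDeriv b x) x := by
  have h1 : HasFDerivAt (fun y : EuclideanSpace ℝ (Fin d) => ‖y‖ ^ 2 • b)
      ((2 • innerSL ℝ x).smulRight b) x :=
    (hasStrictFDerivAt_norm_sq x).hasFDerivAt.smul_const b
  have hc : HasFDerivAt (fun y : EuclideanSpace ℝ (Fin d) => 2 * ⟪b, y⟫) ((2 : ℝ) • innerSL ℝ b) x :=
    ((innerSL ℝ b).hasFDerivAt).const_mul 2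
  have h2 := hc.smul (hasFDerivAt_id (𝕜 := ℝ) x)
  have h := h1.sub h2
  refine h.congr_fderiv (ContinuousLinearMap.ext fun v => ?_)
  simp only [sctFieldDeriv, _root_.sub_apply, _root_.add_apply,
    ContinuousLinearMap.smulRight_apply, _root_.smul_apply, innerSL_apply_apply,
    ContinuousLinearMap.id_apply, id_eq, smul_smul]
  module

/-- **`div K_b = -2d ⟪b, x⟫`**: the trace of `DK_b(x)` is `2⟪x, b⟫ - 2⟪b, x⟫ - 2d⟪b, x⟫`
(Parseval over an orthonormal basis). This is the divergence entering the adjoint of `K_b·∇`, whence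
the coefficient `2Δ - 2d` of the weak identity. [folklore] -/
theorem trace_fderiv_sctField (b x : EuclideanSpace ℝ (Fin d)) :
    LinearMap.trace ℝ _ (fderiv ℝ (sctField b) x : EuclideanSpace ℝ (Fin d) →ₗ[ℝ] _) =
      -(2 * d) * ⟪b, x⟫ := by
  set B := EuclideanSpace.basisFun (Fin d) ℝ with hB
  rw [(hasFDerivAt_sctField b x).fderiv, LinearMap.trace_eq_sum_inner _ B]
  have hP : ∀ v w : EuclideanSpace ℝ (Fin d), ∑ i, ⟪v, B i⟫ * ⟪B i, w⟫ = ⟪v, w⟫ :=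
    fun v w => B.sum_inner_mul_inner v w
  have hone : ∀ i, ⟪B i, B i⟫ = (1 : ℝ) := fun i => by
    rw [real_inner_self_eq_norm_sq, B.orthonormal.1 i, one_pow]
  have hterm : ∀ i, ⟪B i, sctFieldDeriv b x (B i)⟫ =
      2 * (⟪x, B i⟫ * ⟪B i, b⟫) - 2 * (⟪b, B i⟫ * ⟪B i, x⟫) - 2 * ⟪b, x⟫ := fun i => by
    rw [sctFieldDeriv_apply, inner_sub_right, inner_add_right,
      real_inner_smul_right, real_inner_smul_right, real_inner_smul_right, real_inner_smul_right,
      real_inner_smul_right, hone i]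
    ring
  have hterm' : ∀ i, ⟪B i, (sctFieldDeriv b x : EuclideanSpace ℝ (Fin d) →ₗ[ℝ] _) (B i)⟫ =
      2 * (⟪x, B i⟫ * ⟪B i, b⟫) - 2 * (⟪b, B i⟫ * ⟪B i, x⟫) - 2 * ⟪b, x⟫ := fun i => by
    rw [ContinuousLinearMap.coe_coe, hterm i]
  rw [Finset.sum_congr rfl fun i _ => hterm' i, Finset.sum_sub_distrib, Finset.sum_sub_distrib,
    ← Finset.mul_sum, ← Finset.mul_sum, hP x b, hP b x, Finset.sum_const, Finset.card_univ,
    Fintype.card_fin, nsmul_eq_mul, real_inner_comm x b]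
  ring

/-! ### The weak special-conformal Ward identity -/

/-- The **adjoint SCT operator on test functions**: for a test function `φ` on `(ℝᵈ)ⁿ`,
`(2Δ - 2d)(Σᵢ ⟪b, xᵢ⟫) φ(x) + Dφ(x)[(K_b(xᵢ))ᵢ]` — the transpose of `2Δ Σᵢ b·xᵢ - Σᵢ K_b(xᵢ)·∇ᵢ`
(`div K_b = -2d ⟪b, x⟫`, `trace_fderiv_sctField`). [cite: FrancescoMathieuSenechal1997, §4.1 (4.18)] -/
def sctTestOp (Δ : ℝ) (n : ℕ) (b : EuclideanSpace ℝ (Fin d))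
    (φ : (Fin n → EuclideanSpace ℝ (Fin d)) → ℝ) (x : Fin n → EuclideanSpace ℝ (Fin d)) : ℝ :=
  (2 * Δ - 2 * d) * (∑ i, inner ℝ b (x i)) * φ x +
    fderiv ℝ φ x (fun i => ‖x i‖ ^ 2 • b - (2 * inner ℝ b (x i)) • x i)

/-- The configuration field of `sctTestOp` is `(K_b(xᵢ))ᵢ`. [folklore] -/
theorem sctTestOp_eq (Δ : ℝ) (n : ℕ) (b : EuclideanSpace ℝ (Fin d))
    (φ : (Fin n → EuclideanSpace ℝ (Fin d)) → ℝ) (x : Fin n → EuclideanSpace ℝ (Fin d)) :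
    sctTestOp Δ n b φ x =
      (2 * Δ - 2 * d) * (∑ i, ⟪b, x i⟫) * φ x + fderiv ℝ φ x (fun i => sctField b (x i)) :=
  rfl

/-- **The weak special-conformal Ward identity with weight `Δ`** for the `n`-point function of a
correlation family `S` on `ℝᵈ`: for every `b ∈ ℝᵈ` and every test function `φ ∈ C_c^∞` supported
in the non-coincident configurations,
`∫ S_n(x) [(2Δ - 2d)(Σᵢ b·xᵢ) φ(x) + Dφ(x)[(‖xᵢ‖² b - 2(b·xᵢ) xᵢ)ᵢ]] dx = 0` — the distributional
form of the SCT constraint `Σᵢ K_b(xᵢ)·∇ᵢ S_n = 2Δ (Σᵢ b·xᵢ) S_n` on equal-weight quasi-primary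
correlators (Di Francesco–Mathieu–Sénéchal (4.18), (4.51)–(4.54); the integral is Lebesgue/Bochner,
`0` if not integrable). Spelled as inlined in the route `Ising3DConformalLimit/PrimaryAtInfinity`
(`d = 3`: coefficient `2Δ - 6`, `sctWardWeak_iff_coeff`).
[cite: FrancescoMathieuSenechal1997, §4.3.1 (4.51)–(4.54)] -/
def SCTWardWeak (S : CorrFamily d) (Δ : ℝ) (n : ℕ) : Prop :=
  ∀ (b : EuclideanSpace ℝ (Fin d)) (φ : (Fin n → EuclideanSpace ℝ (Fin d)) → ℝ),
    ContDiff ℝ ((⊤ : ℕ∞) : WithTop ℕ∞) φ → HasCompactSupport φ → tsupport φ ⊆ NonCoincident d n →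
      ∫ x, S n x * ((2 * Δ - 2 * d) * (∑ i, inner ℝ b (x i)) * φ x +
        fderiv ℝ φ x (fun i => ‖x i‖ ^ 2 • b - (2 * inner ℝ b (x i)) • x i)) = 0

/-- `SCTWardWeak` folded through the adjoint operator `sctTestOp`. [folklore] -/
theorem sctWardWeak_iff_sctTestOp (S : CorrFamily d) (Δ : ℝ) (n : ℕ) :
    SCTWardWeak S Δ n ↔
      ∀ (b : EuclideanSpace ℝ (Fin d)) (φ : (Fin n → EuclideanSpace ℝ (Fin d)) → ℝ),
        ContDiff ℝ ((⊤ : ℕ∞) : WithTop ℕ∞) φ → HasCompactSupport φ →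
          tsupport φ ⊆ NonCoincident d n → ∫ x, S n x * sctTestOp Δ n b φ x = 0 :=
  Iff.rfl

/-- `SCTWardWeak` with the numerical coefficient rewritten (`κ = 2Δ - 2d`; for `d = 3` take
`κ = 2Δ - 6`, the form inlined in the route). [folklore] -/
theorem sctWardWeak_iff_coeff (S : CorrFamily d) (Δ : ℝ) (n : ℕ) {κ : ℝ} (hκ : 2 * Δ - 2 * d = κ) :
    SCTWardWeak S Δ n ↔
      ∀ (b : EuclideanSpace ℝ (Fin d)) (φ : (Fin n → EuclideanSpace ℝ (Fin d)) → ℝ),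
        ContDiff ℝ ((⊤ : ℕ∞) : WithTop ℕ∞) φ → HasCompactSupport φ →
          tsupport φ ⊆ NonCoincident d n →
            ∫ x, S n x * (κ * (∑ i, inner ℝ b (x i)) * φ x +
              fderiv ℝ φ x (fun i => ‖x i‖ ^ 2 • b - (2 * inner ℝ b (x i)) • x i)) = 0 := by
  subst hκ
  rfl

/-- A vanishing `n`-point function satisfies the weak Ward identity (e.g. odd `n` for an even
family). [folklore] -/
theorem SCTWardWeak.of_forall_eq_zero {S : CorrFamily d} {n : ℕ} (h : ∀ x, S n x = 0) (Δ : ℝ) :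
    SCTWardWeak S Δ n := by
  intro b φ _ _ _
  simp [h]

/-- **The pointwise special-conformal identity with weight `Δ`** on non-coincident configurations:
`D(S_n)(x)[(K_b(xᵢ))ᵢ] = 2Δ (Σᵢ ⟪b, xᵢ⟫) S_n(x)` for every `b` and every `x ∈ NonCoincident d n`
(infinitesimal covariance of a quasi-primary `n`-point function of equal weights `Δ` under the SCT
flow, (4.14)/(4.18) with the Jacobian weight of (4.52)–(4.54)); for `S_n` of class `C¹` it is
equivalent to `SCTWardWeak` (integration by parts, not in this file). [cite: FrancescoMathieuSenechal1997, §4.3.1 (4.51)–(4.54)] -/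
def SCTWardPointwise (S : CorrFamily d) (Δ : ℝ) (n : ℕ) : Prop :=
  ∀ (b : EuclideanSpace ℝ (Fin d)) (x : Fin n → EuclideanSpace ℝ (Fin d)), x ∈ NonCoincident d n →
    fderiv ℝ (S n) x (fun i => sctField b (x i)) = 2 * Δ * (∑ i, ⟪b, x i⟫) * S n x

/-- A vanishing `n`-point function satisfies the pointwise identity. [folklore] -/
theorem SCTWardPointwise.of_forall_eq_zero {S : CorrFamily d} {n : ℕ} (h : ∀ x, S n x = 0) (Δ : ℝ) :
    SCTWardPointwise S Δ n := by
  intro b x _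
  have hS : S n = fun _ => 0 := funext h
  simp [hS]

end Literature.Probability.LatticeModels

end
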